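import Summits.RiemannHypothesis.RiemannHypothesis.Theorems.HandoffDodgerFarTailSummation
import HarnessLib

/-!
# HANDOFF — the FAR ZERO-TAIL of the dodger, evaluation layer I: the pieces of the density integral (rh-explicit, track «HANDOFF», seat prove-2 gen14, ATTEMPT-24 §1, brick FT part 2)

HONEST FRAMING. Nothing here bears on the truth of RH; this is zero COUNTING (RH-free upper-side bookkeeping of the dodger's far-zone cost). Sequel of
`HandoffDodgerFarTailSummation`: the two integrals of `far_stieltjes_le` are bounded piece by piece —

* `exp_neg_le_of_taylor5` (`e^{−x} ≤ 1/T₅(x)`), `log_two_pi_ge` (`log 2π ≥ 1.6931`);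
* `integral_farDensity_piece_le` — on `[Xp, Xq]` (`2π ≤ Xp`) the density integral `∫ (log(t/2π)/(2π)) e^{−X²/t²}/t² dt` is at most
  `(log X + log q − log 2π)/(2π) · e^{−1/q²} · (1/p − 1/q)/X` (monotone majorants, `∫dt/t²` exactly);
* `integral_farDensity_tail_le` — beyond `lo ≥ 2π`: `≤ (log(lo/2π) + 1)/(2π·lo)` (drop the Gaussian, integrate `log(t/2π)/t²` exactly);
* `integral_hswErrDeriv_farWeight_le` — `∫_X^T s₁′ h ≤ 0.18055/X²`.
The grid sum and the sharp cost bound follow in `HandoffDodgerFarTailGridLower` / `HandoffDodgerFarTailGrid` / `HandoffDodgerFarTailSharp`.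
No `sorry`, standard axioms, no definitions.

References: this track (HOME/handoff/prove-2/ATTEMPT-16.md §4 Lemma C3; ATTEMPT-24.md §1). Hasanalizade–Shen–Wong 2022 Cor. 1.2 (tree).
-/

set_option linter.dupNamespace false

noncomputable section

open Real Finset MeasureTheory intervalIntegral Set

namespace Summit.RiemannHypothesis.RiemannHypothesis.Theorems.Handoff

open Literature.NumberTheory.LFunctions Literature.NumberTheory.LFunctions.SchoenfeldBound
  Literature.NumberTheory.LFunctions.KadiriTail

/-! ## Elementary numerics -/

/-- `e^{−x} ≤ 1/(1 + x + x²/2 + x³/6 + x⁴/24 + x⁵/120)` for `x ≥ 0`, in the form: `1 ≤ r·(Taylor₅(x))` ⟹ `e^{−x} ≤ r`. [folklore] -/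
theorem exp_neg_le_of_taylor5 {x r : ℝ} (hx : 0 ≤ x)
    (h : 1 ≤ r * (1 + x + x ^ 2 / 2 + x ^ 3 / 6 + x ^ 4 / 24 + x ^ 5 / 120)) : Real.exp (-x) ≤ r := by
  have hT : 1 + x + x ^ 2 / 2 + x ^ 3 / 6 + x ^ 4 / 24 + x ^ 5 / 120 ≤ Real.exp x := by
    have hs := Real.sum_le_exp_of_nonneg hx 6
    simp only [Finset.sum_range_succ, Finset.sum_range_zero, Nat.factorial, Nat.succ_eq_add_one] at hs
    norm_num at hs
    linarith
  have hT0 : 0 < 1 + x + x ^ 2 / 2 + x ^ 3 / 6 + x ^ 4 / 24 + x ^ 5 / 120 := by positivity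
  have hr : 1 / (1 + x + x ^ 2 / 2 + x ^ 3 / 6 + x ^ 4 / 24 + x ^ 5 / 120) ≤ r := by
    rw [div_le_iff₀ hT0]; exact h
  refine le_trans ?_ hr
  rw [Real.exp_neg, one_div]
  exact inv_anti₀ hT0 hT

/-- `1.6931 ≤ log(2π)` (`log 2 > 0.6931`, `π > e`). [folklore] -/
theorem log_two_pi_ge : (1.6931 : ℝ) ≤ Real.log (2 * π) := by
  have hπ : Real.exp 1 < π := by have := Real.exp_one_lt_d9; have := Real.pi_gt_three; linarith
  have hlπ : 1 < Real.log π := by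
    rw [← Real.exp_lt_exp, Real.exp_log Real.pi_pos]; exact hπ
  rw [Real.log_mul (by norm_num) Real.pi_pos.ne']
  have := Real.log_two_gt_d9
  linarith

/-! ## The pieces of the density integral -/

/-- **One piece.** For `0 < X`, `0 < p ≤ q` with `2π ≤ Xp`:
`∫_{Xp}^{Xq} (log(t/2π)/(2π)) e^{−X²/t²}/t² dt ≤ (log X + log q − log 2π)/(2π) · e^{−1/q²} · ((1/p − 1/q)/X)`
(the logarithm and the Gaussian factor are non-decreasing in `t`, `∫ dt/t² = 1/(Xp) − 1/(Xq)`). [this track, ATTEMPT-24 §1] -/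
theorem integral_farDensity_piece_le {X p q : ℝ} (hX : 0 < X) (hp : 0 < p) (hpq : p ≤ q) (h2π : 2 * π ≤ X * p) :
    ∫ t in X * p..X * q, Real.log (t / (2 * π)) / (2 * π) * (Real.exp (-X ^ 2 / t ^ 2) / t ^ 2) ≤
      (Real.log X + Real.log q - Real.log (2 * π)) / (2 * π) * Real.exp (-1 / q ^ 2) * ((1 / p - 1 / q) / X) := by
  have hπ := Real.pi_pos
  have hq : 0 < q := lt_of_lt_of_le hp hpq
  have hlo : 0 < X * p := by positivity
  have hle : X * p ≤ X * q := by nlinarith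
  set C : ℝ := (Real.log X + Real.log q - Real.log (2 * π)) / (2 * π) * Real.exp (-1 / q ^ 2) with hC
  have hlogXq : Real.log X + Real.log q - Real.log (2 * π) = Real.log (X * q / (2 * π)) := by
    rw [Real.log_div (by positivity) (by positivity), Real.log_mul hX.ne' hq.ne']
  -- pointwise bound by `C / t²`
  have hpt : ∀ t ∈ Icc (X * p) (X * q),
      Real.log (t / (2 * π)) / (2 * π) * (Real.exp (-X ^ 2 / t ^ 2) / t ^ 2) ≤ C * (1 / t ^ 2) := by
    intro t ht
    have ht0 : 0 < t := lt_of_lt_of_le hlo ht.1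
    have hlog_le : Real.log (t / (2 * π)) ≤ Real.log X + Real.log q - Real.log (2 * π) := by
      rw [hlogXq]
      exact Real.log_le_log (by positivity) (div_le_div_of_nonneg_right ht.2 (by positivity))
    have hlog0 : 0 ≤ Real.log (t / (2 * π)) :=
      Real.log_nonneg (by rw [le_div_iff₀ (by positivity)]; linarith [ht.1])
    have hexp_le : Real.exp (-X ^ 2 / t ^ 2) ≤ Real.exp (-1 / q ^ 2) := by
      refine Real.exp_le_exp.2 ?_
      rw [neg_div, neg_div, neg_le_neg_iff, div_le_div_iff₀ (by positivity) (by positivity), one_mul]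
      have : t ^ 2 ≤ (X * q) ^ 2 := pow_le_pow_left₀ ht0.le ht.2 2
      nlinarith
    calc Real.log (t / (2 * π)) / (2 * π) * (Real.exp (-X ^ 2 / t ^ 2) / t ^ 2)
        = (Real.log (t / (2 * π)) / (2 * π) * Real.exp (-X ^ 2 / t ^ 2)) * (1 / t ^ 2) := by ring
      _ ≤ C * (1 / t ^ 2) := by
          refine mul_le_mul_of_nonneg_right ?_ (by positivity)
          rw [hC]
          exact mul_le_mul (div_le_div_of_nonneg_right hlog_le (by positivity)) hexp_le (Real.exp_pos _).le
            (div_nonneg (hlog0.trans hlog_le) (by positivity))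
  -- integrability
  have hi1 : IntervalIntegrable (fun t : ℝ => Real.log (t / (2 * π)) / (2 * π) * (Real.exp (-X ^ 2 / t ^ 2) / t ^ 2))
      volume (X * p) (X * q) := by
    refine ContinuousOn.intervalIntegrable ?_
    rw [uIcc_of_le hle]
    exact continuousOn_of_forall_continuousAt fun t ht => by
      have : 0 < t := lt_of_lt_of_le hlo ht.1
      have : t ≠ 0 := this.ne'
      have : t / (2 * π) ≠ 0 := by positivity
      fun_prop (disch := (first | assumption | positivity))
  have hi2 : IntervalIntegrable (fun t : ℝ => 1 / t ^ 2) volume (X * p) (X * q) := by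
    refine ContinuousOn.intervalIntegrable ?_
    rw [uIcc_of_le hle]
    exact continuousOn_of_forall_continuousAt fun t ht => by
      have : t ≠ 0 := (lt_of_lt_of_le hlo ht.1).ne'
      fun_prop (disch := positivity)
  -- integrate `1/t²`
  have hanti : ∫ t in X * p..X * q, (1 : ℝ) / t ^ 2 = 1 / (X * p) - 1 / (X * q) := by
    have hderiv : ∀ t ∈ uIcc (X * p) (X * q), HasDerivAt (fun s : ℝ => -s⁻¹) (1 / t ^ 2) t := by
      intro t ht
      rw [uIcc_of_le hle] at ht
      have ht0 : t ≠ 0 := (lt_of_lt_of_le hlo ht.1).ne'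
      have h := (hasDerivAt_inv ht0).neg
      refine h.congr_deriv ?_
      field_simp
    rw [intervalIntegral.integral_eq_sub_of_hasDerivAt hderiv hi2]
    field_simp
    ring
  calc ∫ t in X * p..X * q, Real.log (t / (2 * π)) / (2 * π) * (Real.exp (-X ^ 2 / t ^ 2) / t ^ 2)
      ≤ ∫ t in X * p..X * q, C * (1 / t ^ 2) := intervalIntegral.integral_mono_on hle hi1 (hi2.const_mul C) hpt
    _ = C * (1 / (X * p) - 1 / (X * q)) := by rw [intervalIntegral.integral_const_mul, hanti]
    _ = C * ((1 / p - 1 / q) / X) := by congr 1; field_simp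
    _ = (Real.log X + Real.log q - Real.log (2 * π)) / (2 * π) * Real.exp (-1 / q ^ 2) * ((1 / p - 1 / q) / X) := by
        rw [hC]

/-- **The last piece.** For `2π ≤ lo ≤ T` and `X` real:
`∫_{lo}^{T} (log(t/2π)/(2π)) e^{−X²/t²}/t² dt ≤ (log(lo/2π) + 1)/(2π·lo)`
(drop the Gaussian factor; `d/dt[−(log(t/2π)+1)/(2πt)] = log(t/2π)/(2πt²)`). [this track, ATTEMPT-24 §1] -/
theorem integral_farDensity_tail_le {X lo T : ℝ} (hlo : 2 * π ≤ lo) (hT : lo ≤ T) :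
    ∫ t in lo..T, Real.log (t / (2 * π)) / (2 * π) * (Real.exp (-X ^ 2 / t ^ 2) / t ^ 2) ≤
      (Real.log (lo / (2 * π)) + 1) / (2 * π * lo) := by
  have hπ := Real.pi_pos
  have hlo0 : 0 < lo := by linarith [Real.pi_gt_three]
  -- pointwise: drop the Gaussian
  have hpt : ∀ t ∈ Icc lo T, Real.log (t / (2 * π)) / (2 * π) * (Real.exp (-X ^ 2 / t ^ 2) / t ^ 2) ≤
      Real.log (t / (2 * π)) / (2 * π) * (1 / t ^ 2) := by
    intro t ht
    have ht0 : 0 < t := by linarith [ht.1]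
    have hlog0 : 0 ≤ Real.log (t / (2 * π)) :=
      Real.log_nonneg (by rw [le_div_iff₀ (by positivity)]; linarith [ht.1])
    refine mul_le_mul_of_nonneg_left ?_ (by positivity)
    refine div_le_div_of_nonneg_right ?_ (by positivity)
    rw [Real.exp_le_one_iff, neg_div]
    exact neg_nonpos.2 (by positivity)
  have hi1 : IntervalIntegrable (fun t : ℝ => Real.log (t / (2 * π)) / (2 * π) * (Real.exp (-X ^ 2 / t ^ 2) / t ^ 2))
      volume lo T := by
    refine ContinuousOn.intervalIntegrable ?_
    rw [uIcc_of_le hT]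
    exact continuousOn_of_forall_continuousAt fun t ht => by
      have : 0 < t := by linarith [ht.1]
      have : t ≠ 0 := this.ne'
      have : t / (2 * π) ≠ 0 := by positivity
      fun_prop (disch := (first | assumption | positivity))
  have hi2 : IntervalIntegrable (fun t : ℝ => Real.log (t / (2 * π)) / (2 * π) * (1 / t ^ 2)) volume lo T := by
    refine ContinuousOn.intervalIntegrable ?_
    rw [uIcc_of_le hT]
    exact continuousOn_of_forall_continuousAt fun t ht => by
      have : 0 < t := by linarith [ht.1]
      have : t ≠ 0 := this.ne'
      have : t / (2 * π) ≠ 0 := by positivity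
      fun_prop (disch := (first | assumption | positivity))
  -- the antiderivative `F(t) = −(log(t/2π) + 1)/(2πt)`
  have hderiv : ∀ t ∈ uIcc lo T,
      HasDerivAt (fun s : ℝ => -(Real.log (s / (2 * π)) + 1) / (2 * π * s)) (Real.log (t / (2 * π)) / (2 * π) * (1 / t ^ 2)) t := by
    intro t ht
    rw [uIcc_of_le hT] at ht
    have ht0 : 0 < t := by linarith [ht.1]
    have h1 : HasDerivAt (fun s : ℝ => s / (2 * π)) (1 / (2 * π)) t := by
      simpa using (hasDerivAt_id t).div_const (2 * π)
    have h2 : HasDerivAt (fun s : ℝ => Real.log (s / (2 * π))) ((1 / (2 * π)) / (t / (2 * π))) t := h1.log (by positivity)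
    have h3 : HasDerivAt (fun s : ℝ => -(Real.log (s / (2 * π)) + 1)) (-((1 / (2 * π)) / (t / (2 * π)))) t :=
      (h2.add_const 1).neg
    have h4 : HasDerivAt (fun s : ℝ => 2 * π * s) (2 * π) t := by
      simpa using (hasDerivAt_id t).const_mul (2 * π)
    have h5 := h3.div h4 (by positivity : 2 * π * t ≠ 0)
    refine h5.congr_deriv ?_
    field_simp
    ring
  calc ∫ t in lo..T, Real.log (t / (2 * π)) / (2 * π) * (Real.exp (-X ^ 2 / t ^ 2) / t ^ 2)
      ≤ ∫ t in lo..T, Real.log (t / (2 * π)) / (2 * π) * (1 / t ^ 2) := intervalIntegral.integral_mono_on hT hi1 hi2 hpt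
    _ = -(Real.log (T / (2 * π)) + 1) / (2 * π * T) - -(Real.log (lo / (2 * π)) + 1) / (2 * π * lo) :=
        intervalIntegral.integral_eq_sub_of_hasDerivAt hderiv hi2
    _ ≤ (Real.log (lo / (2 * π)) + 1) / (2 * π * lo) := by
        have hT0 : 0 < T := by linarith
        have hlogT : 0 ≤ Real.log (T / (2 * π)) :=
          Real.log_nonneg (by rw [le_div_iff₀ (by positivity)]; linarith)
        have : 0 ≤ (Real.log (T / (2 * π)) + 1) / (2 * π * T) := by positivity
        rw [neg_div, neg_div]
        linarith

/-- **The error-derivative integral.** For `e ≤ X ≤ T`: `∫_X^T (0.1038/t + 0.2573/(t log t)) e^{−X²/t²}/t² dt ≤ 0.18055/X²`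
(`log t ≥ 1`, drop the Gaussian, `∫_X^T dt/t³ ≤ 1/(2X²)`). [this track, ATTEMPT-24 §1] -/
theorem integral_hswErrDeriv_farWeight_le {X T : ℝ} (hX : Real.exp 1 ≤ X) (hT : X ≤ T) :
    ∫ t in X..T, (0.1038 / t + 0.2573 / (t * Real.log t)) * (Real.exp (-X ^ 2 / t ^ 2) / t ^ 2) ≤ 0.18055 / X ^ 2 := by
  have he1 : (1 : ℝ) < Real.exp 1 := by have := Real.exp_one_gt_d9; linarith
  have hX1 : 1 < X := lt_of_lt_of_le he1 hX
  have hX0 : 0 < X := by linarith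
  have hpt : ∀ t ∈ Icc X T, (0.1038 / t + 0.2573 / (t * Real.log t)) * (Real.exp (-X ^ 2 / t ^ 2) / t ^ 2) ≤
      0.3611 * (1 / t ^ 3) := by
    intro t ht
    have ht0 : 0 < t := by linarith [ht.1]
    have hlog1 : 1 ≤ Real.log t := by
      rw [Real.le_log_iff_exp_le ht0]; exact hX.trans ht.1
    have h1 : 0.2573 / (t * Real.log t) ≤ 0.2573 / t := by
      refine div_le_div_of_nonneg_left (by norm_num) ht0 ?_
      nlinarith
    have h2 : 0.1038 / t + 0.2573 / (t * Real.log t) ≤ 0.3611 / t := by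
      have : (0.1038 : ℝ) / t + 0.2573 / t = 0.3611 / t := by ring
      linarith
    have h3 : Real.exp (-X ^ 2 / t ^ 2) / t ^ 2 ≤ 1 / t ^ 2 := by
      refine div_le_div_of_nonneg_right ?_ (by positivity)
      rw [Real.exp_le_one_iff, neg_div]; exact neg_nonpos.2 (by positivity)
    have h4 : 0 ≤ 0.1038 / t + 0.2573 / (t * Real.log t) := by
      have : 0 < Real.log t := by linarith
      positivity
    calc (0.1038 / t + 0.2573 / (t * Real.log t)) * (Real.exp (-X ^ 2 / t ^ 2) / t ^ 2)
        ≤ (0.3611 / t) * (1 / t ^ 2) := mul_le_mul h2 h3 (by positivity) (by positivity)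
      _ = 0.3611 * (1 / t ^ 3) := by field_simp
  have hi1 : IntervalIntegrable (fun t : ℝ => (0.1038 / t + 0.2573 / (t * Real.log t)) * (Real.exp (-X ^ 2 / t ^ 2) / t ^ 2))
      volume X T := by
    refine ContinuousOn.intervalIntegrable ?_
    rw [uIcc_of_le hT]
    exact continuousOn_of_forall_continuousAt fun t ht => by
      have ht1 : 1 < t := by linarith [ht.1]
      have : t ≠ 0 := by positivity
      have : Real.log t ≠ 0 := (Real.log_pos ht1).ne'
      have : t * Real.log t ≠ 0 := by positivity
      fun_prop (disch := (first | assumption | positivity))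
  have hi2 : IntervalIntegrable (fun t : ℝ => (0.3611 : ℝ) * (1 / t ^ 3)) volume X T := by
    refine ContinuousOn.intervalIntegrable ?_
    rw [uIcc_of_le hT]
    exact continuousOn_of_forall_continuousAt fun t ht => by
      have : t ≠ 0 := by linarith [ht.1]
      fun_prop (disch := positivity)
  have hderiv : ∀ t ∈ uIcc X T, HasDerivAt (fun s : ℝ => -(1 / (2 * s ^ 2))) (1 / t ^ 3) t := by
    intro t ht
    rw [uIcc_of_le hT] at ht
    have ht0 : t ≠ 0 := by linarith [ht.1]
    have h1 : HasDerivAt (fun s : ℝ => 2 * s ^ 2) (2 * (2 * t)) t := by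
      simpa using (hasDerivAt_pow 2 t).const_mul 2
    have h2 := (h1.inv (by positivity)).neg
    have e : (fun s : ℝ => -(1 / (2 * s ^ 2))) = fun s => -(2 * s ^ 2)⁻¹ := by ext s; rw [one_div]
    rw [e]
    refine h2.congr_deriv ?_
    field_simp
  have hi3 : IntervalIntegrable (fun t : ℝ => (1 : ℝ) / t ^ 3) volume X T := by
    have := hi2.const_mul (1 / 0.3611)
    refine this.congr fun t _ => ?_
    field_simp
  calc ∫ t in X..T, (0.1038 / t + 0.2573 / (t * Real.log t)) * (Real.exp (-X ^ 2 / t ^ 2) / t ^ 2)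
      ≤ ∫ t in X..T, (0.3611 : ℝ) * (1 / t ^ 3) := intervalIntegral.integral_mono_on hT hi1 hi2 hpt
    _ = 0.3611 * (-(1 / (2 * T ^ 2)) - -(1 / (2 * X ^ 2))) := by
        rw [intervalIntegral.integral_const_mul, intervalIntegral.integral_eq_sub_of_hasDerivAt hderiv hi3]
    _ ≤ 0.18055 / X ^ 2 := by
        have hT0 : 0 < T := by linarith
        have : 0 ≤ 1 / (2 * T ^ 2) := by positivity
        have e : (0.18055 : ℝ) / X ^ 2 = 0.3611 * (1 / (2 * X ^ 2)) := by field_simp; norm_num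
        rw [e]
        nlinarith

end Summit.RiemannHypothesis.RiemannHypothesis.Theorems.Handoff

end
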